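import Summits.AnomalousDissipation.AnomalousDissipation.Theorems.SawtoothPulseCascadeK1LocalisedCascadeHalfStepVCTS

/-!
# K1loc — helper: THE CORNER ZONES OF A HALF-STEP (shared plumbing of the corner-trace half-steps)

Helper file of the prover lane on the crux `K1LocalisedCascade` (stmt-AnomalousDissipation-19491), route
`SawtoothPulseCascade` (S-D fibre ledger, corner-trace track; finding F-p1g9-1).  The zone bookkeeping that `…HalfStepVCTS` /
`…HalfStepHCTS` do inline, as one lemma: for `M ≥ 1` with `Mδ_j < π/2` there is a measurable set `Z ⊂ 𝕋` (the
`Mδ_j/(2πN)`-neighbourhood of the `2N` corners) of measure `≤ 2Mδ_j/π` off which the rounded twist `e^{−2πik_iγU_j}` of every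
fibre `k_i` of the window is `η`-close to the exact `N`-tooth chirp, `η ≥ 2π|k_iG|e^{−M²/2}/(2N)` (`…HalfStepVO.abs_U_sub_tri_le_of_far`).
**`exists_cornerZone`**.  No definitions; nothing about the crux. [cite: Grafakos2014, Prop. 3.1.2 (5)] [problem: turb]
-/

-- `Summit.<Summit>.<Problem>`: single-conjunct summit, the duplicate namespace segment is deliberate.
set_option linter.dupNamespace false

namespace Summit.AnomalousDissipation.AnomalousDissipation.Theorems.SawtoothPulseCascade.K1Window

open MeasureTheory Set Filter Topology UnitAddTorus Function Complex Metric
open scoped Real ENNReal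
open Literature.Analysis Literature.Analysis.FunctionSpaces Literature.Analysis.FunctionSpaces.Torus Literature.Analysis.FluidPDE
open Literature.Analysis.FluidPDE.ShearStage
open Literature.Analysis.FluidPDE.SawtoothCascade Literature.Analysis.FluidPDE.SawtoothCascade.CascadeParams
open Summit.AnomalousDissipation.AnomalousDissipation.Theorems.SawtoothPulseCascade.K1Start
open Summit.AnomalousDissipation.AnomalousDissipation.Theorems.SawtoothPulseCascade.K1Flat

set_option maxHeartbeats 400000 in
/-- **The corner zones** (see the file header): `∃ Z` measurable with `vol Z ≤ 2Mδ_j/π` and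
`‖twist Ψ (k i) x − g0_{k i} x‖ ≤ η` for `x ∉ Z`, every `k ∈ W` (fibre coordinate `i`). [cite: Grafakos2014, Prop. 3.1.2 (5)] -/
theorem exists_cornerZone (P : CascadeParams) {G : ℕ} (hγ : P.γ = G) (hδ₀ : 0 < P.δ₀) (hd : 0 < P.d)
    (hN₀ : 1 ≤ P.N₀) (hρN : 1 ≤ P.ρN) (j : ℕ) (W : Finset (Fin 2 → ℤ)) (i : Fin 2) {M η : ℝ}
    (hM : 1 ≤ M) (hMδ : M * P.δ j < π / 2)
    (hη : ∀ k ∈ W, 2 * π * |((k i * G : ℤ) : ℝ)| * (Real.exp (-(M ^ 2 / 2)) / (2 * P.N j)) ≤ η) :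
    ∃ Z : Set UnitAddCircle, MeasurableSet Z ∧ volume.real Z ≤ 2 * M * P.δ j / π ∧
      ∀ k ∈ W, ∀ x, x ∉ Z → ‖twist (amp ⟨P.U j, P.U_periodic j, P.contDiff_U (P.δ_pos hδ₀ hd j)⟩ P.γ) (k i) x -
        (periodic_exactChirpFun (P.N j) (k i * G)).lift x‖ ≤ η := by
  classical
  have hπ : 0 < π := Real.pi_pos
  have hN : P.N j ≠ 0 := (N_pos P hN₀ hρN j).ne'
  have hNpos : 0 < P.N j := Nat.pos_of_ne_zero hN
  have hNr : (0 : ℝ) < P.N j := by exact_mod_cast hNpos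
  set Ψ : ShearProfile := amp ⟨P.U j, P.U_periodic j, P.contDiff_U (P.δ_pos hδ₀ hd j)⟩ P.γ with hΨ
  have hΨt : ∀ t : ℝ, Ψ t = P.γ * P.U j t := fun t => amp_apply _ _ _
  set g0 : ℤ → UnitAddCircle → ℂ := fun n => (periodic_exactChirpFun (P.N j) (n * G)).lift with hg0
  have hg0t : ∀ n (t : ℝ), g0 n (t : UnitAddCircle) =
      Complex.exp (-(2 * π * I * ((n * G : ℤ)) * ((tri (2 * π * P.N j * t) / (2 * π * P.N j) : ℝ) : ℂ))) :=
    fun n t => (continuous_exactChirp_lift (P.N j) (n * G)).2 t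
  -- the rounding remainder off the `Mδ`-zone
  have hround : ∀ k ∈ W, ∀ u : ℝ, (∀ m : ℤ, M * P.δ j < |2 * π * P.N j * u - (π / 2 + π * m)|) →
      ‖twist Ψ (k i) ((u : ℝ) : UnitAddCircle) - g0 (k i) (u : UnitAddCircle)‖ ≤
        2 * π * |((k i * G : ℤ) : ℝ)| * (Real.exp (-(M ^ 2 / 2)) / (2 * P.N j)) := by
    intro k _ u hfar2
    have hU := abs_U_sub_tri_le_of_far P hδ₀ hd hN₀ hρN hM hMδ hfar2
    rw [twist_coe, hΨt, hγ, hg0t]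
    have e1 : -(2 * ↑π * I * ((k i : ℤ) : ℂ) * (((G : ℝ) * P.U j u : ℝ) : ℂ)) =
        -(2 * π * I * (((k i * G : ℤ) : ℝ) : ℂ) * ((P.U j u : ℝ) : ℂ)) := by push_cast; ring
    have e2 : -(2 * ↑π * I * ((k i * G : ℤ) : ℂ) * ((tri (2 * π * P.N j * u) / (2 * π * P.N j) : ℝ) : ℂ)) =
        -(2 * π * I * (((k i * G : ℤ) : ℝ) : ℂ) * ((tri (2 * π * P.N j * u) / (2 * π * P.N j) : ℝ) : ℂ)) := by
      push_cast; ring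
    rw [e1, e2]
    refine (norm_exp_chirp_sub_le _ _ _).trans ?_
    exact mul_le_mul_of_nonneg_left hU (by positivity)
  -- the corner set and the zone set
  set CF : Finset UnitAddCircle := (Finset.Ico (0 : ℤ) (2 * P.N j)).image
      fun l : ℤ => (((2 * (l : ℝ) + 1) / (4 * P.N j) : ℝ) : UnitAddCircle) with hCF
  have hCFne : CF.Nonempty :=
    Finset.Nonempty.image ⟨0, Finset.mem_Ico.mpr ⟨le_rfl, by exact_mod_cast (by omega : 0 < 2 * P.N j)⟩⟩ _
  have hCFcard : (CF.card : ℝ) ≤ (2 * P.N j : ℕ) := by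
    have h1 : CF.card ≤ (Finset.Ico (0 : ℤ) (2 * P.N j)).card := Finset.card_image_le
    rw [Int.card_Ico] at h1
    exact_mod_cast (by omega : CF.card ≤ 2 * P.N j)
  set C : Set UnitAddCircle := (CF : Set UnitAddCircle) with hC
  set rM : ℝ := M * P.δ j / (2 * π * P.N j) with hrM
  have hM0 : (0 : ℝ) ≤ M := by linarith
  have hrM0 : 0 ≤ rM := by have := (P.δ_pos hδ₀ hd j).le; positivity
  set Z : Set UnitAddCircle := {x | infDist x C ≤ rM} with hZ
  have hZm : MeasurableSet Z := (isClosed_le (continuous_infDist_pt C) continuous_const).measurableSet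
  have hZsub : Z ⊆ ⋃ c ∈ CF, Metric.closedBall c rM := by
    intro x hx; rw [hZ, Set.mem_setOf_eq] at hx
    have hCc : IsCompact C := by rw [hC]; exact CF.finite_toSet.isCompact
    have hCne : C.Nonempty := by rw [hC]; exact_mod_cast hCFne
    obtain ⟨c, hc, hcd⟩ := hCc.exists_infDist_eq_dist hCne x
    rw [hC] at hc; refine Set.mem_iUnion₂.mpr ⟨c, by exact_mod_cast hc, ?_⟩
    rw [Metric.mem_closedBall, ← hcd]; exact hx
  have hZvol : volume.real Z ≤ (2 * P.N j : ℕ) * (2 * rM) := by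
    refine (measureReal_mono hZsub (measure_ne_top _ _)).trans ((measureReal_biUnion_finset_le CF _).trans ?_)
    have hball : ∀ c ∈ CF, volume.real (Metric.closedBall c rM) ≤ 2 * rM := by
      intro c _
      rw [Measure.real, AddCircle.volume_closedBall, ENNReal.toReal_ofReal (le_min zero_le_one (by linarith))]
      exact min_le_right _ _
    refine (Finset.sum_le_sum hball).trans ?_
    rw [Finset.sum_const, nsmul_eq_mul]; exact mul_le_mul_of_nonneg_right hCFcard (by linarith)
  have hr2 : ((2 * P.N j : ℕ) : ℝ) * (2 * rM) = 2 * M * P.δ j / π := by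
    rw [hrM]; push_cast; field_simp
  refine ⟨Z, hZm, hZvol.trans hr2.le, ?_⟩
  -- off the zones the rounded twist is `η`-close to the exact chirp
  intro k hk x hx; rw [hZ, Set.mem_setOf_eq, not_le] at hx
  obtain ⟨u, rfl⟩ := QuotientAddGroup.mk_surjective x
  have e : (QuotientAddGroup.mk u : UnitAddCircle) = ((u : ℝ) : UnitAddCircle) := rfl
  rw [e] at hx ⊢
  refine (hround k hk u fun m => ?_).trans (hη k hk)
  have hph := phase_far_of_le_infDist hNpos (le_refl (infDist ((u : ℝ) : UnitAddCircle) C)) m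
  have : M * P.δ j < 2 * π * P.N j * infDist ((u : ℝ) : UnitAddCircle) C := by
    rw [hrM, div_lt_iff₀ (by positivity)] at hx; linarith
  linarith

end Summit.AnomalousDissipation.AnomalousDissipation.Theorems.SawtoothPulseCascade.K1Window
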